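import Summits.Ventures.LatticeQCDFlow.Scaling.DensityParityTargetSide
import Summits.Ventures.LatticeQCDFlow.Exactness.FlowAcceptanceModelLipschitz
import HarnessLib

/-!
# The target-side parity law for the reweighting ESS — on a general state space

HONEST FRAMING: exact (Metropolis-corrected) sampling algorithms for lattice gauge theory;
figures of merit are autocorrelation/cost numbers at stated couplings and volumes; no
continuum-physics claim.

Venture `LatticeQCDFlow` (cell pub-lqcd), topic `Exactness`; FANOUT row 4 (`s0-u1-b`, rung S0-B:
two independent codes for the 2D U(1) flow sampler compared by acceptance / `τ_int` / ESS).
General-state-space form of `Scaling/DensityParityTargetSide.lean` (same seat, same day; finite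
state spaces), in the setting row 4's codes actually sample (a configuration space `(X, μ)` with
densities), next to `Exactness/FlowAcceptanceModelLipschitz.lean` (the acceptance column:
`|ā(p, q) − ā(p, q')| ≤ (e^δ − 1)∫_{Eᶜ} q + ∫_E q + ∫_E q'`).  NEW WORK of the cell, elementary
integral estimates; nothing is cited as a fact, no definition is introduced.

Setting: `(X, μ)` a measure space; `p` the normalised target density, `q, q' > 0` model densities;
the population reweighting figure of merit of model `q` is the Kish fraction
`ESS(p, q) = (∫ p)²/∫ p²/q = 1/∫ p²/q dμ` (`= 1/E_p[w]`, `w = p/q`; cf. `Scoring/KishESSFromWeightBound`,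
`Exactness/IMHTauIntLeInvESS`: `κ = Z²/W₂`), so the column is the functional `M(q) = ∫ p²/q dμ`,
assumed finite (`Integrable (p²/q)`; otherwise `ESS = 0` and there is nothing to compare).
Parity hypothesis: `|log q x − log q' x| ≤ δ` for every `x ∉ E`, `E` measurable, NOTHING assumed on `E`.

## What is proved

* §1 pointwise: `sq_div_le_exp_mul_sq_div_of_le` (`a ≤ e^δ b ⇒ c²/b ≤ e^δ·c²/a`),
  `abs_sq_div_sub_le_of_abs_log_sub_le` (`|c²/a − c²/b| ≤ (e^δ − 1)·c²/a` at a parity point).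
* §2 **`integral_sq_div_le_of_logParityOff`** / **`integral_sq_div_ge_of_logParityOff`**:
  `e^{−δ}∫_{Eᶜ} p²/q + ∫_E p²/q' ≤ ∫ p²/q' ≤ e^{δ}∫_{Eᶜ} p²/q + ∫_E p²/q'`;
  **`abs_integral_sq_div_sub_le_of_logParityOff`**:
  `|∫ p²/q − ∫ p²/q'| ≤ (e^δ − 1)∫_{Eᶜ} p²/q + ∫_E p²/q + ∫_E p²/q'` — the exceptional set enters
  through its TARGET-WEIGHTED IMPORTANCE MASSES `∫_E p·w dμ`, `∫_E p·w' dμ`.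
* §3 `one_le_integral_sq_div` (`∫ p = ∫ q = 1 ⇒ 1 ≤ ∫ p²/q`, i.e. `ESS ≤ 1`, from
  `0 ≤ ∫ (p − q)²/q`); **`abs_inv_integral_sq_div_sub_le_of_logParityOff`** — the ESS scale:
  `|1/M(q) − 1/M(q')| ≤ (e^δ − 1)/M(q') + ∫_E p²/q + ∫_E p²/q'` for `δ ≥ 0`;
  `setIntegral_sq_div_le_mul_of_div_le` (`p/q ≤ W` on `E` ⇒ `∫_E p²/q ≤ W·∫_E p`: the exceptional
  term is the target mass of `E` times the weight LEVEL on it).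

Reading for row 4 (value-free; no number of ours, no sealed value): as in the finite file — with
`E = {parity fails}` decidable per configuration by running both codes, the three quantities that
pin the ESS column (`δ`, `∫_E p·w`, `∫_E p·w'`) are target expectations of per-configuration
computable functions, i.e. what a parity leg evaluated on target-distributed configurations (the
accepted chain) averages; the acceptance column instead needs the model masses of `E`
(`FlowAcceptanceModelLipschitz`), and the `τ_int` column is pinned by no mass of `E`
(`Scaling/DensityParityCertificates` §2).  NOT CLAIMED: any statistical statement; `τ_int`;
sample ESS; `p ≥ 0` is not even needed (the integrands are `p²/q`); any number re-scored.
-/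

namespace Summit.Ventures.LatticeQCDFlow.Exactness.TargetSideParityESS

open Real MeasureTheory Filter Set
open Summit.Ventures.LatticeQCDFlow.Theory2.DensityParity (le_exp_mul_and_of_abs_log_sub_le)

variable {X : Type*} [MeasurableSpace X] {μ : Measure X} {p q q' : X → ℝ}

/-! ### §1 Pointwise -/

/-- `a ≤ e^δ·b` (`a, b > 0`) gives `c²/b ≤ e^δ·(c²/a)`. [folklore] -/
theorem sq_div_le_exp_mul_sq_div_of_le {a b c δ : ℝ} (ha : 0 < a) (hb : 0 < b)
    (h : a ≤ Real.exp δ * b) : c ^ 2 / b ≤ Real.exp δ * (c ^ 2 / a) := by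
  rw [div_le_iff₀ hb]
  have h1 : Real.exp δ * (c ^ 2 / a) * b = c ^ 2 * (Real.exp δ * b / a) := by ring
  rw [h1]
  exact le_mul_of_one_le_right (sq_nonneg _) ((one_le_div ha).2 h)

/-- At a parity point, `|c²/a − c²/b| ≤ (e^δ − 1)·(c²/a)` (`a, b > 0`, `|log a − log b| ≤ δ`).
[folklore] -/
theorem abs_sq_div_sub_le_of_abs_log_sub_le {a b c δ : ℝ} (ha : 0 < a) (hb : 0 < b)
    (h : |Real.log a - Real.log b| ≤ δ) :
    |c ^ 2 / a - c ^ 2 / b| ≤ (Real.exp δ - 1) * (c ^ 2 / a) := by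
  have hab := le_exp_mul_and_of_abs_log_sub_le ha hb h
  have h1 : c ^ 2 / b ≤ Real.exp δ * (c ^ 2 / a) := sq_div_le_exp_mul_sq_div_of_le ha hb hab.1
  have h2 : c ^ 2 / a ≤ Real.exp δ * (c ^ 2 / b) := sq_div_le_exp_mul_sq_div_of_le hb ha hab.2
  have hA : 0 ≤ c ^ 2 / a := div_nonneg (sq_nonneg _) ha.le
  have hB : 0 ≤ c ^ 2 / b := div_nonneg (sq_nonneg _) hb.le
  have hδ : 0 ≤ δ := (abs_nonneg _).trans h
  have he : 1 ≤ Real.exp δ := by linarith [Real.add_one_le_exp δ]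
  rw [abs_sub_le_iff]
  constructor
  · rcases le_total (c ^ 2 / a) (c ^ 2 / b) with hle | hge
    · linarith [mul_nonneg (sub_nonneg.2 he) hA]
    · nlinarith [mul_nonneg (sub_nonneg.2 he) (sub_nonneg.2 hge)]
  · linarith

/-! ### §2 The law -/

/-- **Upper half**: parity off `E` gives `∫ p²/q' ≤ e^δ·∫_{Eᶜ} p²/q + ∫_E p²/q'`. [folklore] -/
theorem integral_sq_div_le_of_logParityOff (hq0 : ∀ x, 0 < q x) (hq0' : ∀ x, 0 < q' x)
    (hI : Integrable (fun x => p x ^ 2 / q x) μ) (hI' : Integrable (fun x => p x ^ 2 / q' x) μ)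
    {E : Set X} (hE : MeasurableSet E) {δ : ℝ}
    (hlog : ∀ x, x ∉ E → |Real.log (q x) - Real.log (q' x)| ≤ δ) :
    ∫ x, p x ^ 2 / q' x ∂μ
      ≤ Real.exp δ * (∫ x in Eᶜ, p x ^ 2 / q x ∂μ) + ∫ x in E, p x ^ 2 / q' x ∂μ := by
  have hg1 : Integrable (Eᶜ.indicator fun x => Real.exp δ * (p x ^ 2 / q x)) μ :=
    (hI.const_mul _).indicator hE.compl
  have hg2 : Integrable (E.indicator fun x => p x ^ 2 / q' x) μ := hI'.indicator hE
  calc ∫ x, p x ^ 2 / q' x ∂μ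
      ≤ ∫ x, (Eᶜ.indicator (fun x => Real.exp δ * (p x ^ 2 / q x)) x
          + E.indicator (fun x => p x ^ 2 / q' x) x) ∂μ := by
        refine integral_mono hI' (hg1.add hg2) fun x => ?_
        dsimp only
        by_cases hx : x ∈ E
        · rw [indicator_of_notMem (show x ∉ Eᶜ by simpa using hx), indicator_of_mem hx, zero_add]
        · rw [indicator_of_mem (mem_compl hx), indicator_of_notMem hx, add_zero]
          exact sq_div_le_exp_mul_sq_div_of_le (hq0 x) (hq0' x)
            (le_exp_mul_and_of_abs_log_sub_le (hq0 x) (hq0' x) (hlog x hx)).1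
    _ = Real.exp δ * (∫ x in Eᶜ, p x ^ 2 / q x ∂μ) + ∫ x in E, p x ^ 2 / q' x ∂μ := by
        rw [integral_add hg1 hg2, integral_indicator hE.compl, integral_indicator hE,
          integral_const_mul]

/-- **Lower half**: parity off `E` gives `e^{−δ}·∫_{Eᶜ} p²/q + ∫_E p²/q' ≤ ∫ p²/q'`. [folklore] -/
theorem integral_sq_div_ge_of_logParityOff (hq0 : ∀ x, 0 < q x) (hq0' : ∀ x, 0 < q' x)
    (hI : Integrable (fun x => p x ^ 2 / q x) μ) (hI' : Integrable (fun x => p x ^ 2 / q' x) μ)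
    {E : Set X} (hE : MeasurableSet E) {δ : ℝ}
    (hlog : ∀ x, x ∉ E → |Real.log (q x) - Real.log (q' x)| ≤ δ) :
    Real.exp (-δ) * (∫ x in Eᶜ, p x ^ 2 / q x ∂μ) + ∫ x in E, p x ^ 2 / q' x ∂μ
      ≤ ∫ x, p x ^ 2 / q' x ∂μ := by
  have hg1 : Integrable (Eᶜ.indicator fun x => Real.exp (-δ) * (p x ^ 2 / q x)) μ :=
    (hI.const_mul _).indicator hE.compl
  have hg2 : Integrable (E.indicator fun x => p x ^ 2 / q' x) μ := hI'.indicator hE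
  calc Real.exp (-δ) * (∫ x in Eᶜ, p x ^ 2 / q x ∂μ) + ∫ x in E, p x ^ 2 / q' x ∂μ
      = ∫ x, (Eᶜ.indicator (fun x => Real.exp (-δ) * (p x ^ 2 / q x)) x
          + E.indicator (fun x => p x ^ 2 / q' x) x) ∂μ := by
        rw [integral_add hg1 hg2, integral_indicator hE.compl, integral_indicator hE,
          integral_const_mul]
    _ ≤ ∫ x, p x ^ 2 / q' x ∂μ := by
        refine integral_mono (hg1.add hg2) hI' fun x => ?_
        dsimp only
        by_cases hx : x ∈ E
        · rw [indicator_of_notMem (show x ∉ Eᶜ by simpa using hx), indicator_of_mem hx, zero_add]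
        · rw [indicator_of_mem (mem_compl hx), indicator_of_notMem hx, add_zero,
            Real.exp_neg, inv_mul_le_iff₀ (Real.exp_pos δ)]
          exact sq_div_le_exp_mul_sq_div_of_le (hq0' x) (hq0 x)
            (le_exp_mul_and_of_abs_log_sub_le (hq0 x) (hq0' x) (hlog x hx)).2

/-- **The law.**  Two positive model densities that agree to `δ` in log off a measurable set `E`
have, at any common normalised target `p` with finite weight moments,
`|∫ p²/q − ∫ p²/q'| ≤ (e^δ − 1)·∫_{Eᶜ} p²/q + ∫_E p²/q + ∫_E p²/q'` — the exceptional set enters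
through its target-weighted importance masses under the two models (compare
`MeanAcceptLipschitz.abs_meanAccept_sub_le_of_logParityOff`: model masses, for the acceptance).
[folklore] -/
theorem abs_integral_sq_div_sub_le_of_logParityOff (hq0 : ∀ x, 0 < q x) (hq0' : ∀ x, 0 < q' x)
    (hI : Integrable (fun x => p x ^ 2 / q x) μ) (hI' : Integrable (fun x => p x ^ 2 / q' x) μ)
    {E : Set X} (hE : MeasurableSet E) {δ : ℝ}
    (hlog : ∀ x, x ∉ E → |Real.log (q x) - Real.log (q' x)| ≤ δ) :
    |(∫ x, p x ^ 2 / q x ∂μ) - ∫ x, p x ^ 2 / q' x ∂μ|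
      ≤ (Real.exp δ - 1) * (∫ x in Eᶜ, p x ^ 2 / q x ∂μ)
        + (∫ x in E, p x ^ 2 / q x ∂μ + ∫ x in E, p x ^ 2 / q' x ∂μ) := by
  have hg1 : Integrable (Eᶜ.indicator fun x => (Real.exp δ - 1) * (p x ^ 2 / q x)) μ :=
    (hI.const_mul _).indicator hE.compl
  have hg2 : Integrable (E.indicator fun x => p x ^ 2 / q x + p x ^ 2 / q' x) μ :=
    (hI.add hI').indicator hE
  rw [← integral_sub hI hI']
  calc |∫ x, (p x ^ 2 / q x - p x ^ 2 / q' x) ∂μ|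
      ≤ ∫ x, |p x ^ 2 / q x - p x ^ 2 / q' x| ∂μ := abs_integral_le_integral_abs
    _ ≤ ∫ x, (Eᶜ.indicator (fun x => (Real.exp δ - 1) * (p x ^ 2 / q x)) x
          + E.indicator (fun x => p x ^ 2 / q x + p x ^ 2 / q' x) x) ∂μ := by
        refine integral_mono ((hI.sub hI').abs) (hg1.add hg2) fun x => ?_
        dsimp only
        by_cases hx : x ∈ E
        · rw [indicator_of_notMem (show x ∉ Eᶜ by simpa using hx), indicator_of_mem hx, zero_add,
            abs_sub_le_iff]
          have h1 : 0 ≤ p x ^ 2 / q x := div_nonneg (sq_nonneg _) (hq0 x).le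
          have h2 : 0 ≤ p x ^ 2 / q' x := div_nonneg (sq_nonneg _) (hq0' x).le
          constructor <;> linarith
        · rw [indicator_of_mem (mem_compl hx), indicator_of_notMem hx, add_zero]
          exact abs_sq_div_sub_le_of_abs_log_sub_le (hq0 x) (hq0' x) (hlog x hx)
    _ = (Real.exp δ - 1) * (∫ x in Eᶜ, p x ^ 2 / q x ∂μ)
          + (∫ x in E, p x ^ 2 / q x ∂μ + ∫ x in E, p x ^ 2 / q' x ∂μ) := by
        rw [integral_add hg1 hg2, integral_indicator hE.compl, integral_indicator hE,
          integral_const_mul, integral_add hI.integrableOn hI'.integrableOn]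

/-! ### §3 The ESS scale and the size of the exceptional term -/

/-- **`ESS ≤ 1` on a general state space**: for a normalised target density `p` and a positive
normalised model density `q` with `∫ p²/q < ∞`, `1 ≤ ∫ p²/q dμ` — from `0 ≤ ∫ (p − q)²/q dμ =
∫ p²/q − 2∫ p + ∫ q`. [folklore] -/
theorem one_le_integral_sq_div (hpi : Integrable p μ) (hp1 : ∫ x, p x ∂μ = 1)
    (hq0 : ∀ x, 0 < q x) (hqi : Integrable q μ) (hq1 : ∫ x, q x ∂μ = 1)
    (hI : Integrable (fun x => p x ^ 2 / q x) μ) : 1 ≤ ∫ x, p x ^ 2 / q x ∂μ := by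
  have e : (fun x => (p x - q x) ^ 2 / q x) = fun x => p x ^ 2 / q x - 2 * p x + q x := by
    funext x
    have hqx := (hq0 x).ne'
    field_simp
    ring
  have h2p : Integrable (fun x => 2 * p x) μ := hpi.const_mul 2
  have hf : Integrable (fun x => p x ^ 2 / q x - 2 * p x) μ := hI.sub h2p
  have h0 : 0 ≤ ∫ x, (p x - q x) ^ 2 / q x ∂μ :=
    integral_nonneg fun x => div_nonneg (sq_nonneg _) (hq0 x).le
  rw [e, integral_add hf hqi, integral_sub hI h2p, integral_const_mul, hp1, hq1] at h0
  linarith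

/-- **The law on the ESS scale.**  With `M(q) = ∫ p²/q` (so `ESS(p, q) = 1/M(q) ≤ 1`), both models
normalised and `δ ≥ 0`:
`|1/M(q) − 1/M(q')| ≤ (e^δ − 1)·(1/M(q')) + ∫_E p²/q + ∫_E p²/q'`
(`|1/M − 1/M'| = |M − M'|/(M M')`, `∫_{Eᶜ} p²/q ≤ M`, `M, M' ≥ 1`). [folklore] -/
theorem abs_inv_integral_sq_div_sub_le_of_logParityOff (hpi : Integrable p μ)
    (hp1 : ∫ x, p x ∂μ = 1) (hq0 : ∀ x, 0 < q x) (hqi : Integrable q μ) (hq1 : ∫ x, q x ∂μ = 1)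
    (hq0' : ∀ x, 0 < q' x) (hqi' : Integrable q' μ) (hq1' : ∫ x, q' x ∂μ = 1)
    (hI : Integrable (fun x => p x ^ 2 / q x) μ) (hI' : Integrable (fun x => p x ^ 2 / q' x) μ)
    {E : Set X} (hE : MeasurableSet E) {δ : ℝ} (hδ : 0 ≤ δ)
    (hlog : ∀ x, x ∉ E → |Real.log (q x) - Real.log (q' x)| ≤ δ) :
    |(∫ x, p x ^ 2 / q x ∂μ)⁻¹ - (∫ x, p x ^ 2 / q' x ∂μ)⁻¹|
      ≤ (Real.exp δ - 1) * (∫ x, p x ^ 2 / q' x ∂μ)⁻¹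
        + (∫ x in E, p x ^ 2 / q x ∂μ + ∫ x in E, p x ^ 2 / q' x ∂μ) := by
  have hM1 : 1 ≤ ∫ x, p x ^ 2 / q x ∂μ := one_le_integral_sq_div hpi hp1 hq0 hqi hq1 hI
  have hM1' : 1 ≤ ∫ x, p x ^ 2 / q' x ∂μ := one_le_integral_sq_div hpi hp1 hq0' hqi' hq1' hI'
  have hlaw := abs_integral_sq_div_sub_le_of_logParityOff hq0 hq0' hI hI' hE hlog
  have hB0 : 0 ≤ ∫ x in E, p x ^ 2 / q x ∂μ :=
    setIntegral_nonneg hE fun x _ => div_nonneg (sq_nonneg _) (hq0 x).le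
  have hB'0 : 0 ≤ ∫ x in E, p x ^ 2 / q' x ∂μ :=
    setIntegral_nonneg hE fun x _ => div_nonneg (sq_nonneg _) (hq0' x).le
  have hsplit : (∫ x in E, p x ^ 2 / q x ∂μ) + ∫ x in Eᶜ, p x ^ 2 / q x ∂μ = ∫ x, p x ^ 2 / q x ∂μ :=
    integral_add_compl hE hI
  set M := ∫ x, p x ^ 2 / q x ∂μ with hM
  set M' := ∫ x, p x ^ 2 / q' x ∂μ with hM'
  set A := ∫ x in Eᶜ, p x ^ 2 / q x ∂μ with hA
  set B := ∫ x in E, p x ^ 2 / q x ∂μ with hB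
  set B' := ∫ x in E, p x ^ 2 / q' x ∂μ with hB'
  have hM0 : 0 < M := one_pos.trans_le hM1
  have hM0' : 0 < M' := one_pos.trans_le hM1'
  have hAM : A ≤ M := by linarith
  have hx : 0 ≤ Real.exp δ - 1 := by linarith [Real.add_one_le_exp δ]
  have key : M⁻¹ - M'⁻¹ = M⁻¹ * M'⁻¹ * (M' - M) := by
    field_simp
  rw [key, abs_mul, abs_of_pos (mul_pos (inv_pos.2 hM0) (inv_pos.2 hM0')), abs_sub_comm]
  have hinv1 : M⁻¹ ≤ 1 := inv_le_one_of_one_le₀ hM1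
  have hinv1' : M'⁻¹ ≤ 1 := inv_le_one_of_one_le₀ hM1'
  have hMA : M⁻¹ * A ≤ 1 := by
    calc M⁻¹ * A ≤ M⁻¹ * M := mul_le_mul_of_nonneg_left hAM (inv_pos.2 hM0).le
      _ = 1 := inv_mul_cancel₀ hM0.ne'
  have hMM : M⁻¹ * M'⁻¹ ≤ 1 := by
    calc M⁻¹ * M'⁻¹ ≤ 1 * 1 :=
          mul_le_mul hinv1 hinv1' (inv_pos.2 hM0').le zero_le_one
      _ = 1 := one_mul 1
  have h1 : (Real.exp δ - 1) * (M⁻¹ * A) * M'⁻¹ ≤ (Real.exp δ - 1) * 1 * M'⁻¹ :=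
    mul_le_mul_of_nonneg_right (mul_le_mul_of_nonneg_left hMA hx) (inv_pos.2 hM0').le
  have h2 : M⁻¹ * M'⁻¹ * (B + B') ≤ 1 * (B + B') :=
    mul_le_mul_of_nonneg_right hMM (add_nonneg hB0 hB'0)
  calc M⁻¹ * M'⁻¹ * |M - M'|
      ≤ M⁻¹ * M'⁻¹ * ((Real.exp δ - 1) * A + (B + B')) :=
        mul_le_mul_of_nonneg_left hlaw (mul_pos (inv_pos.2 hM0) (inv_pos.2 hM0')).le
    _ = (Real.exp δ - 1) * (M⁻¹ * A) * M'⁻¹ + M⁻¹ * M'⁻¹ * (B + B') := by ring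
    _ ≤ (Real.exp δ - 1) * 1 * M'⁻¹ + 1 * (B + B') := add_le_add h1 h2
    _ = (Real.exp δ - 1) * M'⁻¹ + (B + B') := by ring

/-- **The exceptional term is the target mass of `E` times the weight level on `E`**: if
`p/q ≤ W` on `E` (and `p ≥ 0` there) then `∫_E p²/q ≤ W·∫_E p`. [folklore] -/
theorem setIntegral_sq_div_le_mul_of_div_le (hp0 : ∀ x, 0 ≤ p x) (hpi : Integrable p μ)
    (hI : Integrable (fun x => p x ^ 2 / q x) μ)
    {E : Set X} (hE : MeasurableSet E) {W : ℝ} (hW : ∀ x ∈ E, p x / q x ≤ W) :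
    ∫ x in E, p x ^ 2 / q x ∂μ ≤ W * ∫ x in E, p x ∂μ := by
  rw [← integral_const_mul]
  refine setIntegral_mono_on hI.integrableOn (hpi.const_mul W).integrableOn hE fun x hx => ?_
  have h : p x ^ 2 / q x = p x / q x * p x := by rw [sq, mul_div_right_comm]
  rw [h]
  exact mul_le_mul_of_nonneg_right (hW x hx) (hp0 x)

end Summit.Ventures.LatticeQCDFlow.Exactness.TargetSideParityESS
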